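import Mathlib

/-!
# Fraction-free star–mesh (Markov state) elimination for the sensitive spanning-tree witness

Support file for item `stmt-ValiantsHypothesis-10464` (`SensitiveStDivisionEasy`, route
DivisionGap): the DEFINITIONS of the elimination scheme and their unfolding lemmas. The
identities are proved in `DivisionGapSensitiveStDivisionEasyDet.lean`, the size count and the
item itself in `DivisionGapSensitiveStDivisionEasy.lean`.

We set up, over an arbitrary commutative semiring `R`, the fraction-free vertex elimination of the
complete digraph on `Option (Fin N)` (root `none`) with generic edge weights `x_{(i,v)}`:
eliminating the non-root vertex `κ` replaces the weight `w_{iv}` by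
`S_κ · w_{iv} + w_{iκ} · w_{κv}` (`S_κ = Σ_{v ≠ κ} w_{κv}`, the pivot) and kills the edges into `κ`,
together with three accumulators `ps = ∏ S_κ`, `pr = ∏ R_κ` (`R_κ` = full row mass of `κ`,
self-loop included) and the telescoped deficit `u` (`u' = u · R_κ + w_{κκ} · ps`). All of this is
subtraction-free, so it makes sense over `ℝ≥0`; probabilistically it is state elimination in the
Markov chain "jump from `i` to `v` with probability `x_{(i,v)} / R_i`", whose absorption
probability at the root is `ST / F` (Markov chain tree theorem).

SHARING without multi-output circuits (the device of `IMMInVPProofs.lean`): the state after `k`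
eliminations is the image of the state variables under `k` successive SUBSTITUTIONS (`lower`,
`aeval_init_lower`), so the substitution bound `complexity_aeval_le` will give every final state
polynomial fan-in-two `complexity` `O(N⁴)`.

Contents: the state variables `St N`, one step `stepV`/`step`, forward values `val`, backward
substitution `lower`; the derived pivots `S`, row masses `Rt`, self-loops `ell`, their
`ℕ`-indexed versions, the full polynomial `fPoly = F_{n-1,n}`; over a commutative ring the reduced
Laplacian `lap` of the current weights, its live part `lapLive`, the determinant `D`, and the
block decomposition (`blkA`–`blkD`, `splitEquiv`) used for the Schur-complement step; the size
constant `Cstep`.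
-/

noncomputable section

-- `Summit.<Summit>.<Problem>` repeats `ValiantsHypothesis` by the tree's layout convention (D-0017).
set_option linter.dupNamespace false

namespace Summit.ValiantsHypothesis.ValiantsHypothesis.Theorems

namespace SensitiveStElim

open MvPolynomial Finset

universe u

/-- Edge variables `x_{(i,v)}`: an edge from the non-root vertex `i` to the vertex `v`
(`none` = the root). -/
abbrev Edge (N : ℕ) : Type := Fin N × Option (Fin N)

/-- State variables of the elimination: the current edge weights and three accumulators
(`Sum.inr 0` = `ps`, `Sum.inr 1` = `pr`, `Sum.inr 2` = `u`). -/
abbrev St (N : ℕ) : Type := Edge N ⊕ Fin 3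

/-- The live (not yet eliminated) non-root vertices at level `k`. -/
abbrev Live (N k : ℕ) : Type := {i : Fin N // k ≤ (i : ℕ)}

/-- The per-level substitution cost `(N(N+1)+3)(N+4)`: `N(N+1)+3` state variables, each
replaced by a polynomial of complexity `≤ N + 4`. -/
def Cstep (N : ℕ) : ℕ := (N * (N + 1) + 3) * (N + 4)

/-- There are `N(N+1) + 3` state variables. -/
theorem card_St (N : ℕ) : Fintype.card (St N) = N * (N + 1) + 3 := by
  simp [Fintype.card_sum, Fintype.card_prod, Fintype.card_option]

/-- The number of live vertices at level `k` is `N - k`. -/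
theorem card_Live (N k : ℕ) : Fintype.card (Live N k) = N - k := by
  rw [← Fintype.card_fin (N - k)]
  refine Fintype.card_congr
    { toFun := fun i => ⟨(i.1 : ℕ) - k, by have := i.2; have := i.1.isLt; omega⟩
      invFun := fun j => ⟨⟨(j : ℕ) + k, by omega⟩, by simp⟩
      left_inv := fun i =>
        Subtype.ext (Fin.ext (show ((i.1 : ℕ) - k) + k = (i.1 : ℕ) by have := i.2; omega))
      right_inv := fun j => Fin.ext (show ((j : ℕ) + k) - k = (j : ℕ) by omega) }

section Scheme

variable (R : Type u) [CommSemiring R] (N : ℕ)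

/-- The pivot `S_κ = Σ_{v ≠ some κ} x_{(κ,v)}` as a polynomial in the state variables. -/
def sVar (κ : Fin N) : MvPolynomial (St N) R :=
  ∑ v ∈ univ.erase (some κ), X (Sum.inl (κ, v))

/-- The full row mass `R_κ = Σ_v x_{(κ,v)}` (self-loop included) in the state variables. -/
def rVar (κ : Fin N) : MvPolynomial (St N) R :=
  ∑ v : Option (Fin N), X (Sum.inl (κ, v))

/-- One elimination step at the vertex `κ`, as a substitution of the state variables:
`w_{iv} ↦ 0` if `v = κ`, else `S_κ w_{iv} + w_{iκ} w_{κv}`; `ps ↦ ps · S_κ`; `pr ↦ pr · R_κ`;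
`u ↦ u · R_κ + w_{κκ} · ps`. -/
def stepV (κ : Fin N) : St N → MvPolynomial (St N) R
  | Sum.inl (i, v) =>
      if v = some κ then 0
      else sVar R N κ * X (Sum.inl (i, v)) + X (Sum.inl (i, some κ)) * X (Sum.inl (κ, v))
  | Sum.inr j =>
      (![X (Sum.inr 0) * sVar R N κ, X (Sum.inr 1) * rVar R N κ,
          X (Sum.inr 2) * rVar R N κ + X (Sum.inl (κ, some κ)) * X (Sum.inr 0)] :
        Fin 3 → MvPolynomial (St N) R) j

/-- The `k`-th substitution: eliminate vertex `k` if `k < N`, the identity afterwards. -/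
def step (k : ℕ) : St N → MvPolynomial (St N) R :=
  if h : k < N then stepV R N ⟨k, h⟩ else X

/-- Initial values of the state variables: the edge variables themselves, `ps = pr = 1`,
`u = 0`. -/
def init : St N → MvPolynomial (Edge N) R
  | Sum.inl e => X e
  | Sum.inr j => (![1, 1, 0] : Fin 3 → MvPolynomial (Edge N) R) j

/-- The values of the state variables after `k` elimination steps (forward recursion). -/
def val : ℕ → St N → MvPolynomial (Edge N) R
  | 0 => init R N
  | k + 1 => fun w => aeval (val k) (step R N k w)

/-- `lower k φ`: a polynomial in the level-`k` state variables, rewritten as a polynomial in the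
level-`0` state variables by `k` successive substitutions (backward recursion). -/
def lower : ℕ → MvPolynomial (St N) R → MvPolynomial (St N) R
  | 0 => fun φ => φ
  | k + 1 => fun φ => lower k (aeval (step R N k) φ)

variable {R N}

/-- The pivot `S_κ` at level `κ` (row mass of `κ` without its self-loop). -/
def S (κ : Fin N) : MvPolynomial (Edge N) R :=
  ∑ v ∈ univ.erase (some κ), val R N κ (Sum.inl (κ, v))

/-- The full row mass `R_κ` of `κ` at level `κ` (self-loop included). -/
def Rt (κ : Fin N) : MvPolynomial (Edge N) R :=
  ∑ v : Option (Fin N), val R N κ (Sum.inl (κ, v))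

/-- The self-loop weight `ℓ_κ = w_{κκ}` at level `κ`. -/
def ell (κ : Fin N) : MvPolynomial (Edge N) R :=
  val R N κ (Sum.inl (κ, some κ))

variable (R N)

/-- `ℕ`-indexed pivots (junk value `1` from `N` on). -/
def S' (k : ℕ) : MvPolynomial (Edge N) R := if h : k < N then S ⟨k, h⟩ else 1

/-- The row mass `r_i = Σ_v x_{(i,v)}` of the input. -/
def rowX (i : Fin N) : MvPolynomial (Edge N) R :=
  ∑ v : Option (Fin N), X (i, v)

/-- `ℕ`-indexed row masses (junk value `1` from `N` on). -/
def rowX' (k : ℕ) : MvPolynomial (Edge N) R :=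
  if h : k < N then rowX R N ⟨k, h⟩ else 1

/-- `F = ∏_i r_i`, the full set-multilinear polynomial `F_{n-1,n} = Σ_t ∏_i x_{(i, t i)}`. -/
def fPoly : MvPolynomial (Edge N) R :=
  ∏ i : Fin N, rowX R N i

/-! ### Semantics of `lower` -/

/-- Substituting the initial values into `lower k φ` is substituting the level-`k` values
into `φ`. -/
theorem aeval_init_lower (k : ℕ) (φ : MvPolynomial (St N) R) :
    aeval (init R N) (lower R N k φ) = aeval (val R N k) φ := by
  induction k generalizing φ with
  | zero => rfl
  | succ k ih =>
    simp only [lower, ih]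
    rw [comp_aeval_apply]
    rfl

/-- In particular every level-`k` value is a `k`-fold substitution instance. -/
theorem val_eq_aeval_lower (k : ℕ) (w : St N) :
    val R N k w = aeval (init R N) (lower R N k (X w)) := by
  rw [aeval_init_lower, aeval_X]

/-! ### The forward recursion, unfolded -/

variable {R N}

/-- `R_κ = S_κ + ℓ_κ`. -/
theorem Rt_eq (κ : Fin N) : Rt (R := R) κ = S κ + ell κ := by
  unfold Rt S ell
  rw [add_comm]
  exact (Finset.add_sum_erase univ (fun v => val R N κ (Sum.inl (κ, v))) (mem_univ _)).symm

/-- Level `0`: the edge weights are the variables. -/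
@[simp] theorem val_zero_inl (e : Edge N) : val R N 0 (Sum.inl e) = X e := rfl

/-- Level `0`: `ps = 1`. -/
@[simp] theorem val_zero_ps : val R N 0 (Sum.inr 0) = 1 := rfl

/-- Level `0`: `pr = 1`. -/
@[simp] theorem val_zero_pr : val R N 0 (Sum.inr 1) = 1 := rfl

/-- Level `0`: `u = 0`. -/
@[simp] theorem val_zero_u : val R N 0 (Sum.inr 2) = 0 := rfl

/-- The defining recursion of `val`. -/
theorem val_succ (k : ℕ) (w : St N) :
    val R N (k + 1) w = aeval (val R N k) (step R N k w) := rfl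

/-- After the last vertex the values freeze. -/
theorem val_succ_of_le {k : ℕ} (hk : N ≤ k) (w : St N) : val R N (k + 1) w = val R N k w := by
  rw [val_succ, step, dif_neg (not_lt.mpr hk), aeval_X]

/-- Substituting the level-`κ` values into `sVar κ` gives the pivot `S_κ`. -/
theorem aeval_val_sVar (κ : Fin N) : aeval (val R N κ) (sVar R N κ) = S κ := by
  simp [sVar, S, map_sum]

/-- Substituting the level-`κ` values into `rVar κ` gives the row mass `R_κ`. -/
theorem aeval_val_rVar (κ : Fin N) : aeval (val R N κ) (rVar R N κ) = Rt κ := by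
  simp [rVar, Rt, map_sum]

/-- Before the last vertex, a step is `stepV`. -/
theorem val_succ_eq (κ : Fin N) (w : St N) :
    val R N (κ + 1) w = aeval (val R N κ) (stepV R N κ w) := by
  rw [val_succ, step, dif_pos κ.isLt]

/-- The star–mesh rule: `w'_{iv} = 0` if `v = κ`, else `S_κ w_{iv} + w_{iκ} w_{κv}`. -/
theorem val_succ_inl (κ : Fin N) (i : Fin N) (v : Option (Fin N)) :
    val R N (κ + 1) (Sum.inl (i, v)) =
      if v = some κ then 0
      else S κ * val R N κ (Sum.inl (i, v)) +
        val R N κ (Sum.inl (i, some κ)) * val R N κ (Sum.inl (κ, v)) := by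
  rw [val_succ_eq]
  simp only [stepV]
  split_ifs with h
  · exact map_zero _
  · rw [map_add, map_mul, map_mul, aeval_X, aeval_X, aeval_X, aeval_val_sVar]

/-- `ps' = ps · S_κ`. -/
theorem val_succ_ps (κ : Fin N) :
    val R N (κ + 1) (Sum.inr 0) = val R N κ (Sum.inr 0) * S κ := by
  rw [val_succ_eq]
  simp only [stepV, Matrix.cons_val_zero]
  rw [map_mul, aeval_X, aeval_val_sVar]

/-- `pr' = pr · R_κ`. -/
theorem val_succ_pr (κ : Fin N) :
    val R N (κ + 1) (Sum.inr 1) = val R N κ (Sum.inr 1) * Rt κ := by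
  rw [val_succ_eq]
  simp only [stepV, Matrix.cons_val_one, Matrix.cons_val_zero]
  rw [map_mul, aeval_X, aeval_val_rVar]

/-- `u' = u · R_κ + ℓ_κ · ps`. -/
theorem val_succ_u (κ : Fin N) :
    val R N (κ + 1) (Sum.inr 2) =
      val R N κ (Sum.inr 2) * Rt κ + ell κ * val R N κ (Sum.inr 0) := by
  rw [val_succ_eq]
  simp only [stepV, Matrix.cons_val_two, Matrix.tail_cons, Matrix.head_cons]
  rw [map_add, map_mul, map_mul, aeval_X, aeval_X, aeval_X, aeval_val_rVar]
  rfl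

/-- `S' κ = S κ` below `N`. -/
theorem S'_eq (κ : Fin N) : S' R N κ = S κ := by
  simp [S', κ.isLt]

/-! ### Change of scalars: the recursion has coefficients `0, 1` -/

section Map

variable {R' : Type*} [CommSemiring R'] (f : R →+* R')

/-- `sVar` is defined over `ℕ`. -/
theorem map_sVar (κ : Fin N) : map f (sVar R N κ) = sVar R' N κ := by
  simp [sVar, _root_.map_sum]

/-- `rVar` is defined over `ℕ`. -/
theorem map_rVar (κ : Fin N) : map f (rVar R N κ) = rVar R' N κ := by
  simp [rVar, _root_.map_sum]

/-- `stepV` is defined over `ℕ`. -/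
theorem map_stepV (κ : Fin N) (w : St N) : map f (stepV R N κ w) = stepV R' N κ w := by
  rcases w with ⟨i, v⟩ | j
  · simp only [stepV]
    split_ifs
    · exact _root_.map_zero _
    · simp [map_sVar]
  · fin_cases j <;> simp [stepV, map_sVar, map_rVar]

/-- `step` is defined over `ℕ`. -/
theorem map_step (k : ℕ) (w : St N) : map f (step R N k w) = step R' N k w := by
  unfold step
  split_ifs
  · exact map_stepV f _ w
  · exact map_X f w

/-- `init` is defined over `ℕ`. -/
theorem map_init (w : St N) : map f (init R N w) = init R' N w := by
  rcases w with e | j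
  · exact map_X f e
  · fin_cases j <;> simp [init]

/-- The level-`k` values over `R'` are the images of those over `R`. -/
theorem map_val (k : ℕ) (w : St N) : map f (val R N k w) = val R' N k w := by
  induction k generalizing w with
  | zero => exact map_init f w
  | succ k ih =>
    rw [val_succ, val_succ, aeval_eq_bind₁, aeval_eq_bind₁, map_bind₁, map_step]
    exact congrArg (fun g => bind₁ g (step R' N k w)) (funext ih)

/-- `F` is defined over `ℕ`. -/
theorem map_fPoly : map f (fPoly R N) = fPoly R' N := by
  simp [fPoly, rowX, _root_.map_prod, _root_.map_sum]

end Map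

end Scheme

/-! ### The reduced Laplacian of the current weights (over a commutative ring) -/

section Laplacian

variable (R : Type u) [CommRing R] (N : ℕ)

/-- The reduced Laplacian of the level-`k` weights on all of `Fin N`:
diagonal `Σ_{v ≠ some i} w_{iv}`, off-diagonal `-w_{ij}`. -/
def lap (k : ℕ) : Matrix (Fin N) (Fin N) (MvPolynomial (Edge N) R) :=
  Matrix.of fun i j =>
    if i = j then ∑ v ∈ univ.erase (some i), val R N k (Sum.inl (i, v))
    else -val R N k (Sum.inl (i, some j))

/-- Its restriction to the live vertices. -/
def lapLive (k : ℕ) : Matrix (Live N k) (Live N k) (MvPolynomial (Edge N) R) :=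
  (lap R N k).submatrix Subtype.val Subtype.val

/-- `D k`: the determinant of the live Laplacian at level `k`. -/
def D (k : ℕ) : MvPolynomial (Edge N) R := (lapLive R N k).det

/-- Pivot block `[L_{κκ}] = [S_κ]` of the live Laplacian at level `κ`. -/
def blkA (κ : Fin N) : Matrix Unit Unit (MvPolynomial (Edge N) R) :=
  Matrix.of fun _ _ => lap R N κ κ κ

/-- Pivot row of the live Laplacian at level `κ`. -/
def blkB (κ : Fin N) : Matrix Unit (Live N (κ + 1)) (MvPolynomial (Edge N) R) :=
  Matrix.of fun _ j => lap R N κ κ j.1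

/-- Pivot column of the live Laplacian at level `κ`. -/
def blkC (κ : Fin N) : Matrix (Live N (κ + 1)) Unit (MvPolynomial (Edge N) R) :=
  Matrix.of fun i _ => lap R N κ i.1 κ

/-- The live Laplacian at level `κ` off the pivot. -/
def blkD (κ : Fin N) : Matrix (Live N (κ + 1)) (Live N (κ + 1)) (MvPolynomial (Edge N) R) :=
  Matrix.of fun i j => lap R N κ i.1 j.1

/-- Live vertices at level `κ` = the pivot `κ` plus the live vertices at level `κ + 1`. -/
def splitEquiv (κ : Fin N) : Live N κ ≃ Unit ⊕ Live N (κ + 1) where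
  toFun i := if h : (i.1 : ℕ) = κ then Sum.inl () else Sum.inr ⟨i.1, by have := i.2; omega⟩
  invFun := Sum.elim (fun _ => ⟨κ, le_rfl⟩) (fun j => ⟨j.1, by have := j.2; omega⟩)
  left_inv i := by
    by_cases h : (i.1 : ℕ) = κ
    · dsimp only
      rw [dif_pos h]
      exact Subtype.ext (Fin.ext h.symm)
    · dsimp only
      rw [dif_neg h]
      rfl
  right_inv x := by
    rcases x with ⟨⟨⟩⟩ | ⟨j, hj⟩
    · exact dif_pos rfl
    · have h : (j : ℕ) ≠ κ := by omega
      exact dif_neg h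

end Laplacian

end SensitiveStElim

end Summit.ValiantsHypothesis.ValiantsHypothesis.Theorems
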